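import Literature.Barriers.CriticalPhenomena.LongRangeTrivialityOnZ3TwoPoint
import Literature.Probability.LatticeModels.MessagerMiracleSoleFree

/-!
# The Messager–Miracle-Solé inequality for ferromagnetic PAIR interactions on `ℤ^d`
# (finite volume, free boundary condition, and the infinite-volume state along boxes)

Sibling of `Literature/Barriers/CriticalPhenomena/LongRangeTrivialityOnZ3TwoPoint.lean` (barrier
catalogue D-0021, sub-problem `Ising3DConformalLimit`), first half of the discharge of the named fact
`panis_mms_two_point_monotone` (Panis 2023, arXiv:2309.05797, Corollary 3.3 (MMS2), resting on
Proposition 3.2, "MMS inequalities, [Heger, MMS, RS]": for a region `Λ` with a reflection symmetry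
`Θ` and `A, B` on the same side of the plane, `⟨∏_A τ ∏_B τ⟩_Λ ≥ ⟨∏_A τ ∏_{Θ(B)} τ⟩_Λ`, extended in the
infinite-volume limit to hyperplanes through sites or mid-edges and to diagonal hyperplanes).

The tree proves the Messager–Miracle-Solé inequality for the NEAREST-NEIGHBOUR Ising model
(`Literature/Probability/LatticeModels/MessagerMiracleSole(Free).lean`) by the folding argument of
Messager–Miracle-Solé 1977 / Hegerfeldt 1977: in the even/odd variables `s_u = (σ_u + σ_{θu})/2`,
`t_u = (σ_u - σ_{θu})/2` the Hamiltonian of a `θ`-symmetric ferromagnet is again ferromagnetic, so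
that Griffiths' first inequality in the new variables gives `⟨σ_a(σ_b - σ_{θb})⟩ ≥ 0`. This file runs
the SAME abstract machinery (`foldedClass`, `IsFoldedTerm`, `sum_foldedClass_mul_exp_nonneg` of
`MessagerMiracleSole.lean`) for the general ferromagnetic pair interactions
`H_{Λ,J,0}(σ) = -∑_{{x,y}⊂Λ} J_{x,y}σ_xσ_y` of `LongRangeTrivialityOnZ3.lean` (`LongRangeIsing.expectIn`,
free boundary condition, zero field), under the hypotheses of Hegerfeldt 1977 / Messager–Miracle-Solé
1977 for pair interactions:

* `J ≥ 0` (ferromagnetic), `J_{θx,θy} = J_{x,y}` (reflection invariance), and the reflection-domination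
  condition `J_{x,θy} ≤ J_{x,y}` for distinct `x, y` on the positive side of the plane;
* the geometry of `MessagerMiracleSole.lean`: an involution `θ` of `ℤ^d`, a positive side `P` with
  `θ(P) ∩ P = ∅`, every site off `P ∪ θ(P)` fixed by `θ`, and a `θ`-stable volume `Λ`.

Folding of the energy (`neg_mul_pairHamiltonian_eq_sum_fold`): by `θ`-invariance,
`-βH = (β/4) ∑_{x,y∈Λ} [(J_{x,y} + J_{x,θy}) S_xS_y + (J_{x,y} - J_{x,θy}) T_xT_y]` with
`S_z = (σ_z + σ_{θz})/2`, `T_z = (σ_z - σ_{θz})/2`; every summand is a folded term with nonnegative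
coefficients (`isFoldedTerm_pairTerm`: the diagonal terms `y = x`, `y = θx` fold to `(β/2)J_{x,θx}S_x² + c`
by `S² + T² = 1`; a fixed endpoint kills the `T`-term; otherwise `T_xT_y = ±t_{x̂}t_{ŷ}` for the
representatives `x̂, ŷ ∈ P` and the sign of `J_{x,y} - J_{x,θy}` matches by reflection domination and
`θ`-invariance). Hence GKS I holds for the folded free state
(`sum_foldedClass_mul_pairGibbsWeight_nonneg`) and, exactly as in the nearest-neighbour files,
`⟨σ_aσ_{θb}⟩_{Λ,J,0,β} ≤ ⟨σ_aσ_b⟩_{Λ,J,0,β}` for `a ≠ b` on the positive side (`expectIn_pair_reflect_le`).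
The infinite-volume state `LongRangeIsing.state` (the limit along the boxes `Λ_L`) is also the limit
along the `θ`-symmetrised boxes `Λ_L ∪ θΛ_L` when `θ` moves boxes boundedly (`tendsto_expectIn_symBox`,
sandwich by monotonicity of free correlations in the volume), whence the inequality for the state
(`state_pair_reflect_le`). Finally the state is invariant under the signed coordinate permutations of
`ℤ^d` preserving `J` (`state_spinProduct_map_signedPerm`).

The specialisation to the reflections through `{yᵢ = k/2}` and `{yᵢ - yⱼ = c}` for couplings that
are nonincreasing functions of `|x-y|₁` (in particular `C₀|x-y|₁^{-d-α}`), and the walk from these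
elementary monotonicity steps to Corollary 3.3 (MMS2), are in the sibling
`LongRangeTrivialityOnZ3MMSWalk.lean`.

## References

* R. Panis, arXiv:2309.05797 (2023) = Ann. Probab. 54 (2026), §3.2, Proposition 3.2 and
  Corollary 3.3 [Panis2023Triviality] (held; read pp. 13–14).
* A. Messager, S. Miracle-Solé, *Correlation functions and boundary conditions in the Ising
  ferromagnet*, J. Stat. Phys. 17 (1977) 245–262 [MessagerMiracleSoleJSP1977].
* G. C. Hegerfeldt, *Correlation inequalities for Ising ferromagnets with symmetries*, Comm. Math.
  Phys. 57 (1977) 259–266, §2 Main Lemma (2.8), Thms. 3.1–3.2 [Hegerfeldt1977].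
* S. Friedli, Y. Velenik, *Statistical Mechanics of Lattice Systems*, CUP (2017), Exercises 3.12,
  3.14 [FriedliVelenik2017].
-/

noncomputable section

namespace Literature.Barriers.CriticalPhenomena

open Literature.Probability.LatticeModels Literature.Probability.Percolation Filter Topology Finset
open scoped symmDiff

namespace LongRangeIsing

variable {d : ℕ}

/-! ### Folding the pair Hamiltonian along an involution -/

section PairFold

variable (J : Site d → Site d → ℝ) (θ : Site d ≃ Site d) (P : Site d → Prop) [DecidablePred P]
  (Λ : Finset (Site d)) (β : ℝ)

omit [DecidablePred P] in
/-- Reindexing a sum over a `θ`-stable volume by `θ`. [folklore] -/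
theorem sum_comp_of_stable {θ : Site d ≃ Site d} {Λ : Finset (Site d)}
    (hΛ : ∀ x, x ∈ Λ ↔ θ x ∈ Λ) (F : Site d → ℝ) : ∑ x ∈ Λ, F (θ x) = ∑ x ∈ Λ, F x :=
  Finset.sum_equiv θ (fun x => hΛ x) (fun _ _ => rfl)

omit [DecidablePred P] in
/-- **The free pair Hamiltonian of a `θ`-symmetric volume in the even/odd variables**
`S_z = (σ_z + σ_{θz})/2`, `T_z = (σ_z - σ_{θz})/2`: for `θ` an involution with `J_{θx,θy} = J_{x,y}` and
`θ(Λ) = Λ`,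
`-βH_{Λ,J,0}(σ) = (β/2)∑_{x,y∈Λ} J_{x,y}σ_xσ_y = ∑_{(x,y)∈Λ²} (β/4)[(J_{x,y} + J_{x,θy}) S_xS_y + (J_{x,y} - J_{x,θy}) T_xT_y]`
(average the four reindexings `(x,y)`, `(θx,θy)`, `(x,θy)`, `(θx,y)` of the double sum; the change
of variables of Messager–Miracle-Solé 1977, Hegerfeldt 1977 §2 for pair interactions).
[cite: Hegerfeldt1977, §2, Main Lemma, eq. (2.8)] -/
theorem neg_mul_pairHamiltonian_eq_sum_fold (hθ : Function.Involutive θ)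
    (hJθ : ∀ x y, J (θ x) (θ y) = J x y) (hΛ : ∀ x, x ∈ Λ ↔ θ x ∈ Λ) (ω : SpinConfig ↥Λ) :
    -β * pairHamiltonian J Λ 0 (glue Λ ω .free) =
      ∑ p ∈ Λ ×ˢ Λ, β / 4 * ((J p.1 p.2 + J p.1 (θ p.2)) * (siteS θ Λ p.1 ω * siteS θ Λ p.2 ω) +
        (J p.1 p.2 - J p.1 (θ p.2)) * (siteT θ Λ p.1 ω * siteT θ Λ p.2 ω)) := by
  rw [glue_free_eq_glue_plus_cfg, Finset.sum_product]
  set G : Site d → Site d → ℝ :=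
    fun x y => J x y * spinAt x (glue Λ ω .plus) * spinAt y (glue Λ ω .plus) with hG
  have hre : ∀ F : Site d → ℝ, ∑ x ∈ Λ, F (θ x) = ∑ x ∈ Λ, F x := fun F => sum_comp_of_stable hΛ F
  have hB : ∑ x ∈ Λ, ∑ y ∈ Λ, G (θ x) (θ y) = ∑ x ∈ Λ, ∑ y ∈ Λ, G x y := by
    rw [← hre (fun x => ∑ y ∈ Λ, G x y)]
    exact Finset.sum_congr rfl fun x _ => hre (G (θ x))
  have hC : ∑ x ∈ Λ, ∑ y ∈ Λ, G x (θ y) = ∑ x ∈ Λ, ∑ y ∈ Λ, G x y :=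
    Finset.sum_congr rfl fun x _ => hre (G x)
  have hD : ∑ x ∈ Λ, ∑ y ∈ Λ, G (θ x) y = ∑ x ∈ Λ, ∑ y ∈ Λ, G x y :=
    hre (fun x => ∑ y ∈ Λ, G x y)
  have hpt : ∀ x y, β / 4 * ((J x y + J x (θ y)) * (siteS θ Λ x ω * siteS θ Λ y ω) +
      (J x y - J x (θ y)) * (siteT θ Λ x ω * siteT θ Λ y ω)) =
      β / 8 * G x y + β / 8 * G (θ x) (θ y) + β / 8 * G x (θ y) + β / 8 * G (θ x) y := by
    intro x y
    have h1 : J (θ x) (θ y) = J x y := hJθ x y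
    have h2 : J (θ x) y = J x (θ y) := by
      have h := hJθ x (θ y)
      rwa [hθ y] at h
    simp only [hG, siteS, siteT, h1, h2]
    ring
  simp only [hpt, Finset.sum_add_distrib, ← Finset.mul_sum]
  rw [hB, hC, hD]
  have hA : ∑ x ∈ Λ, ∑ y ∈ Λ, J x y * spinAt x (glue Λ ω .plus) * spinAt y (glue Λ ω .plus) =
      ∑ x ∈ Λ, ∑ y ∈ Λ, G x y := rfl
  simp only [pairHamiltonian, zero_mul, sub_zero]
  rw [hA]
  ring

variable {J θ P Λ β}

/-- The diagonal terms `y = x` fold to `(β/2) J_{x,θx} S_x² + (β/4)(J_{x,x} - J_{x,θx})`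
(`S_x² + T_x² = 1`), a folded term for `J ≥ 0`. [cite: MessagerMiracleSoleJSP1977, main theorem (monotonicity of ⟨σ₀σ_x⟩ under reflections)] -/
theorem isFoldedTerm_pairTerm_self (hθ : Function.Involutive θ)
    (hfix : ∀ x, ¬P x → ¬P (θ x) → θ x = x) (hJ0 : ∀ x y, 0 ≤ J x y)
    (hΛ : ∀ x, x ∈ Λ ↔ θ x ∈ Λ) (hβ : 0 ≤ β) (x : Site d) :
    IsFoldedTerm (foldedClass (volInvol θ Λ hΛ) (volSide P Λ))
      (fun ω => β / 4 * ((J x x + J x (θ x)) * (siteS θ Λ x ω * siteS θ Λ x ω) +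
        (J x x - J x (θ x)) * (siteT θ Λ x ω * siteT θ Λ x ω))) :=
  ⟨β / 2 * J x (θ x), 0, β / 4 * (J x x - J x (θ x)), fun ω => siteS θ Λ x ω * siteS θ Λ x ω,
    fun _ => 1, mul_nonneg (by positivity) (hJ0 _ _), le_rfl,
    mul_mem_foldedClass _ _ (siteS_mem_foldedClass hθ hfix hΛ x) (siteS_mem_foldedClass hθ hfix hΛ x),
    one_mem_foldedClass _ _, fun ω => by
      have h := siteS_sq_add_siteT_sq θ Λ x ω
      linear_combination (β / 4 * (J x x - J x (θ x))) * h⟩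

/-- The anti-diagonal terms `y = θx` fold to the same folded term
`(β/2) J_{x,θx} S_x² + (β/4)(J_{x,x} - J_{x,θx})` (`S_{θx} = S_x`, `T_{θx} = -T_x`). [cite: MessagerMiracleSoleJSP1977, main theorem (monotonicity of ⟨σ₀σ_x⟩ under reflections)] -/
theorem isFoldedTerm_pairTerm_self_apply (hθ : Function.Involutive θ)
    (hfix : ∀ x, ¬P x → ¬P (θ x) → θ x = x) (hJ0 : ∀ x y, 0 ≤ J x y)
    (hΛ : ∀ x, x ∈ Λ ↔ θ x ∈ Λ) (hβ : 0 ≤ β) (x : Site d) :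
    IsFoldedTerm (foldedClass (volInvol θ Λ hΛ) (volSide P Λ))
      (fun ω => β / 4 * ((J x (θ x) + J x (θ (θ x))) * (siteS θ Λ x ω * siteS θ Λ (θ x) ω) +
        (J x (θ x) - J x (θ (θ x))) * (siteT θ Λ x ω * siteT θ Λ (θ x) ω))) := by
  refine ⟨β / 2 * J x (θ x), 0, β / 4 * (J x x - J x (θ x)), fun ω => siteS θ Λ x ω * siteS θ Λ x ω,
    fun _ => 1, mul_nonneg (by positivity) (hJ0 _ _), le_rfl,
    mul_mem_foldedClass _ _ (siteS_mem_foldedClass hθ hfix hΛ x) (siteS_mem_foldedClass hθ hfix hΛ x),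
    one_mem_foldedClass _ _, fun ω => ?_⟩
  simp only [hθ x, siteS_apply θ Λ hθ, siteT_apply θ Λ hθ]
  have h := siteS_sq_add_siteT_sq θ Λ x ω
  linear_combination (β / 4 * (J x x - J x (θ x))) * h

/-- A pair with `T_x T_y ≡ 0` (an endpoint on the reflection plane) folds to
`(β/4)(J_{x,y} + J_{x,θy}) S_xS_y`. [cite: MessagerMiracleSoleJSP1977, main theorem (monotonicity of ⟨σ₀σ_x⟩ under reflections)] -/
theorem isFoldedTerm_pairTerm_of_siteT (hθ : Function.Involutive θ)
    (hfix : ∀ x, ¬P x → ¬P (θ x) → θ x = x) (hJ0 : ∀ x y, 0 ≤ J x y)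
    (hΛ : ∀ x, x ∈ Λ ↔ θ x ∈ Λ) (hβ : 0 ≤ β) {x y : Site d}
    (hT : ∀ ω, siteT θ Λ x ω * siteT θ Λ y ω = 0) :
    IsFoldedTerm (foldedClass (volInvol θ Λ hΛ) (volSide P Λ))
      (fun ω => β / 4 * ((J x y + J x (θ y)) * (siteS θ Λ x ω * siteS θ Λ y ω) +
        (J x y - J x (θ y)) * (siteT θ Λ x ω * siteT θ Λ y ω))) :=
  ⟨β / 4 * (J x y + J x (θ y)), 0, 0, fun ω => siteS θ Λ x ω * siteS θ Λ y ω, fun _ => 1,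
    mul_nonneg (by positivity) (add_nonneg (hJ0 _ _) (hJ0 _ _)), le_rfl,
    mul_mem_foldedClass _ _ (siteS_mem_foldedClass hθ hfix hΛ x) (siteS_mem_foldedClass hθ hfix hΛ y),
    one_mem_foldedClass _ _, fun ω => by simp only [hT ω]; ring⟩

/-- **The generic pair folds to a ferromagnetic term** under reflection domination: for `x ≠ y`,
`x ≠ θy` in `Λ`, both off the plane, `(β/4)[(J_{x,y} + J_{x,θy})S_xS_y + (J_{x,y} - J_{x,θy})T_xT_y]`
is `a S_xS_y + b t_{x̂}t_{ŷ}` with `a, b ≥ 0`, where `x̂, ŷ` are the representatives of `x, y` on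
the positive side: `T_z = ± t_{ẑ}`, and the sign of `J_{x,y} - J_{x,θy}` is `+` when `x, y` are on the
same side and `-` otherwise, by `J_{x,θy} ≤ J_{x,y}` on the positive side and `J_{θx,θy} = J_{x,y}`
(Hegerfeldt 1977, §2, condition (2.6) `J(θ_A B) ≤ J(B)`; Messager–Miracle-Solé 1977).
[cite: Hegerfeldt1977, §2, Main Lemma, eq. (2.8)] -/
theorem isFoldedTerm_pairTerm_of_ne (hθ : Function.Involutive θ)
    (hfix : ∀ x, ¬P x → ¬P (θ x) → θ x = x) (hJ0 : ∀ x y, 0 ≤ J x y)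
    (hJθ : ∀ x y, J (θ x) (θ y) = J x y) (hJP : ∀ x y, P x → P y → x ≠ y → J x (θ y) ≤ J x y)
    (hΛ : ∀ x, x ∈ Λ ↔ θ x ∈ Λ) (hβ : 0 ≤ β) {x y : Site d} (hx : x ∈ Λ) (hy : y ∈ Λ)
    (hfx : θ x ≠ x) (hfy : θ y ≠ y) (hxy : x ≠ y) (hxy' : x ≠ θ y) :
    IsFoldedTerm (foldedClass (volInvol θ Λ hΛ) (volSide P Λ))
      (fun ω => β / 4 * ((J x y + J x (θ y)) * (siteS θ Λ x ω * siteS θ Λ y ω) +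
        (J x y - J x (θ y)) * (siteT θ Λ x ω * siteT θ Λ y ω))) := by
  set θv := volInvol θ Λ hΛ with hθv
  have hside : ∀ z, θ z ≠ z → ¬P z → P (θ z) := fun z hz hPz => by
    by_contra h
    exact hz (hfix z hPz h)
  have hS : (fun ω => siteS θ Λ x ω * siteS θ Λ y ω) ∈ foldedClass θv (volSide P Λ) :=
    mul_mem_foldedClass _ _ (siteS_mem_foldedClass hθ hfix hΛ x) (siteS_mem_foldedClass hθ hfix hΛ y)
  have ha : 0 ≤ β / 4 * (J x y + J x (θ y)) :=
    mul_nonneg (by positivity) (add_nonneg (hJ0 _ _) (hJ0 _ _))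
  have hJ1 : J (θ x) (θ y) = J x y := hJθ x y
  have hJ2 : J (θ x) y = J x (θ y) := by
    have h := hJθ x (θ y)
    rwa [hθ y] at h
  have ht : ∀ {z : Site d}, P z → ∀ hz : z ∈ Λ, tVar θv ⟨z, hz⟩ ∈ foldedClass θv (volSide P Λ) :=
    fun hPz hz => tVar_mem_foldedClass _ _ ((mem_volSide P Λ).2 hPz)
  by_cases hPx : P x
  · by_cases hPy : P y
    · refine ⟨β / 4 * (J x y + J x (θ y)), β / 4 * (J x y - J x (θ y)), 0,
        fun ω => siteS θ Λ x ω * siteS θ Λ y ω, fun ω => tVar θv ⟨x, hx⟩ ω * tVar θv ⟨y, hy⟩ ω,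
        ha, mul_nonneg (by positivity) (sub_nonneg.2 (hJP x y hPx hPy hxy)), hS,
        mul_mem_foldedClass _ _ (ht hPx hx) (ht hPy hy), fun ω => ?_⟩
      simp only [siteT_of_mem θ Λ hΛ hx, siteT_of_mem θ Λ hΛ hy, hθv]
      ring
    · have hPθy : P (θ y) := hside y hfy hPy
      have hb : 0 ≤ β / 4 * (J x (θ y) - J x y) := by
        have h := hJP x (θ y) hPx hPθy hxy'
        rw [hθ y] at h
        exact mul_nonneg (by positivity) (sub_nonneg.2 h)
      refine ⟨β / 4 * (J x y + J x (θ y)), β / 4 * (J x (θ y) - J x y), 0,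
        fun ω => siteS θ Λ x ω * siteS θ Λ y ω,
        fun ω => tVar θv ⟨x, hx⟩ ω * tVar θv ⟨θ y, (hΛ y).1 hy⟩ ω,
        ha, hb, hS, mul_mem_foldedClass _ _ (ht hPx hx) (ht hPθy ((hΛ y).1 hy)), fun ω => ?_⟩
      simp only [siteT_of_mem θ Λ hΛ hx, siteT_of_mem' θ Λ hθ hΛ hy, hθv]
      ring
  · have hPθx : P (θ x) := hside x hfx hPx
    by_cases hPy : P y
    · have hb : 0 ≤ β / 4 * (J x (θ y) - J x y) := by
        have h := hJP (θ x) y hPθx hPy (fun h => hxy' (by rw [← h, hθ x]))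
        rw [hJ1, hJ2] at h
        exact mul_nonneg (by positivity) (sub_nonneg.2 h)
      refine ⟨β / 4 * (J x y + J x (θ y)), β / 4 * (J x (θ y) - J x y), 0,
        fun ω => siteS θ Λ x ω * siteS θ Λ y ω,
        fun ω => tVar θv ⟨θ x, (hΛ x).1 hx⟩ ω * tVar θv ⟨y, hy⟩ ω,
        ha, hb, hS, mul_mem_foldedClass _ _ (ht hPθx ((hΛ x).1 hx)) (ht hPy hy), fun ω => ?_⟩
      simp only [siteT_of_mem' θ Λ hθ hΛ hx, siteT_of_mem θ Λ hΛ hy, hθv]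
      ring
    · have hPθy : P (θ y) := hside y hfy hPy
      have hb : 0 ≤ β / 4 * (J x y - J x (θ y)) := by
        have h := hJP (θ x) (θ y) hPθx hPθy (fun h => hxy (hθ.injective h))
        rw [hθ y, hJ2, hJ1] at h
        exact mul_nonneg (by positivity) (sub_nonneg.2 h)
      refine ⟨β / 4 * (J x y + J x (θ y)), β / 4 * (J x y - J x (θ y)), 0,
        fun ω => siteS θ Λ x ω * siteS θ Λ y ω,
        fun ω => tVar θv ⟨θ x, (hΛ x).1 hx⟩ ω * tVar θv ⟨θ y, (hΛ y).1 hy⟩ ω,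
        ha, hb, hS, mul_mem_foldedClass _ _ (ht hPθx ((hΛ x).1 hx)) (ht hPθy ((hΛ y).1 hy)),
        fun ω => ?_⟩
      simp only [siteT_of_mem' θ Λ hθ hΛ hx, siteT_of_mem' θ Λ hθ hΛ hy, hθv]
      ring

/-- **Every term of the folded pair Hamiltonian is ferromagnetic in the even/odd variables**
(dispatch on `y = x`, `y = θx`, an endpoint on the plane, or the generic case).
[cite: Hegerfeldt1977, §2, Main Lemma, eq. (2.8)] -/
theorem isFoldedTerm_pairTerm (hθ : Function.Involutive θ)
    (hfix : ∀ x, ¬P x → ¬P (θ x) → θ x = x) (hJ0 : ∀ x y, 0 ≤ J x y)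
    (hJθ : ∀ x y, J (θ x) (θ y) = J x y) (hJP : ∀ x y, P x → P y → x ≠ y → J x (θ y) ≤ J x y)
    (hΛ : ∀ x, x ∈ Λ ↔ θ x ∈ Λ) (hβ : 0 ≤ β) {x y : Site d} (hx : x ∈ Λ) (hy : y ∈ Λ) :
    IsFoldedTerm (foldedClass (volInvol θ Λ hΛ) (volSide P Λ))
      (fun ω => β / 4 * ((J x y + J x (θ y)) * (siteS θ Λ x ω * siteS θ Λ y ω) +
        (J x y - J x (θ y)) * (siteT θ Λ x ω * siteT θ Λ y ω))) := by
  by_cases hyx : y = x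
  · subst hyx
    exact isFoldedTerm_pairTerm_self hθ hfix hJ0 hΛ hβ y
  by_cases hyx' : y = θ x
  · subst hyx'
    exact isFoldedTerm_pairTerm_self_apply hθ hfix hJ0 hΛ hβ x
  by_cases hfx : θ x = x
  · exact isFoldedTerm_pairTerm_of_siteT hθ hfix hJ0 hΛ hβ fun ω => by
      rw [siteT_of_fixed θ Λ hfx]; ring
  by_cases hfy : θ y = y
  · exact isFoldedTerm_pairTerm_of_siteT hθ hfix hJ0 hΛ hβ fun ω => by
      rw [siteT_of_fixed θ Λ hfy]; ring
  exact isFoldedTerm_pairTerm_of_ne hθ hfix hJ0 hJθ hJP hΛ hβ hx hy hfx hfy (Ne.symm hyx)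
    fun h => hyx' (by rw [h, hθ y])

/-- **First Griffiths inequality for the folded free pair-interaction state**: in a `θ`-symmetric
volume, `∑_ω M(ω) e^{-βH_{Λ,J,0}(ω·free)} ≥ 0` for every folded monomial `M` in the variables
`s, t, σ_f`, when `β ≥ 0`, `J ≥ 0` is `θ`-invariant and reflection-dominated on the positive side
(Messager–Miracle-Solé 1977, proof of the main theorem; Hegerfeldt 1977, §2, Main Lemma).
[cite: Hegerfeldt1977, §2, Main Lemma, eq. (2.8)] -/
theorem sum_foldedClass_mul_pairGibbsWeight_nonneg (hθ : Function.Involutive θ)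
    (hPθ : ∀ x, P x → ¬P (θ x)) (hfix : ∀ x, ¬P x → ¬P (θ x) → θ x = x)
    (hJ0 : ∀ x y, 0 ≤ J x y) (hJθ : ∀ x y, J (θ x) (θ y) = J x y)
    (hJP : ∀ x y, P x → P y → x ≠ y → J x (θ y) ≤ J x y)
    (hΛ : ∀ x, x ∈ Λ ↔ θ x ∈ Λ) (hβ : 0 ≤ β) :
    ∀ M ∈ foldedClass (volInvol θ Λ hΛ) (volSide P Λ),
      0 ≤ ∑ ω, M ω * pairGibbsWeight J Λ β 0 ω := by
  intro M hM
  have hθv : Function.Involutive (volInvol θ Λ hΛ) := fun z => Subtype.ext (hθ z)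
  have hPv : ∀ u ∈ volSide P Λ, volInvol θ Λ hΛ u ∉ volSide P Λ := fun u hu => by
    rw [mem_volSide] at hu ⊢
    exact hPθ u hu
  have hw : ∀ ω : SpinConfig ↥Λ, M ω * pairGibbsWeight J Λ β 0 ω =
      M ω * (Real.exp (∑ p ∈ Λ ×ˢ Λ, β / 4 * ((J p.1 p.2 + J p.1 (θ p.2)) *
        (siteS θ Λ p.1 ω * siteS θ Λ p.2 ω) +
        (J p.1 p.2 - J p.1 (θ p.2)) * (siteT θ Λ p.1 ω * siteT θ Λ p.2 ω))) *
          (fun _ => (1 : ℝ)) ω) := by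
    intro ω
    rw [pairGibbsWeight, neg_mul_pairHamiltonian_eq_sum_fold J θ Λ β hθ hJθ hΛ ω, mul_one]
  rw [Finset.sum_congr rfl fun ω _ => hw ω]
  refine sum_foldedClass_mul_exp_nonneg _ _ (Λ ×ˢ Λ) _ (fun p hp => ?_)
    (sum_foldedClass_mul_one_nonneg hθv hPv) M hM
  obtain ⟨hx, hy⟩ := Finset.mem_product.1 hp
  exact isFoldedTerm_pairTerm hθ hfix hJ0 hJθ hJP hΛ hβ hx hy

variable (J θ P Λ β) in
/-- **The Messager–Miracle-Solé inequality for ferromagnetic pair interactions in finite volume**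
(free boundary condition, zero field; pair form): for an involution `θ` of `ℤ^d`, a positive side
`P` with `θ(P) ∩ P = ∅` and all sites off `P ∪ θ(P)` fixed, a `θ`-stable volume `Λ`, `β ≥ 0`, and a
coupling `J ≥ 0` with `J_{θx,θy} = J_{x,y}` and `J_{x,θy} ≤ J_{x,y}` for distinct `x, y` on the
positive side, `⟨σ_aσ_{θb}⟩_{Λ,J,0,β} ≤ ⟨σ_aσ_b⟩_{Λ,J,0,β}` for `a ≠ b` on the positive side (Panis
2023, Proposition 3.2 with `A = {a}`, `B = {b}`; Messager–Miracle-Solé 1977; Hegerfeldt 1977, §3,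
eq. (3.7), free boundary conditions; in the even/odd variables `σ_a(σ_b - σ_{θb}) = 2s_at_b + 2t_at_b`).
[cite: Panis2023Triviality, Proposition 3.2] -/
theorem expectIn_pair_reflect_le (hθ : Function.Involutive θ)
    (hPθ : ∀ x, P x → ¬P (θ x)) (hfix : ∀ x, ¬P x → ¬P (θ x) → θ x = x)
    (hJ0 : ∀ x y, 0 ≤ J x y) (hJθ : ∀ x y, J (θ x) (θ y) = J x y)
    (hJP : ∀ x y, P x → P y → x ≠ y → J x (θ y) ≤ J x y)
    (hΛ : ∀ x, x ∈ Λ ↔ θ x ∈ Λ) (hβ : 0 ≤ β)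
    {a b : Site d} (ha : a ∈ Λ) (hb : b ∈ Λ) (hPa : P a) (hPb : P b) (hab : a ≠ b) :
    expectIn J Λ β 0 (spinProduct {a, θ b}) ≤ expectIn J Λ β 0 (spinProduct {a, b}) := by
  have haθb : a ≠ θ b := fun h' => hPθ b hPb (h' ▸ hPa)
  rw [expectIn, expectIn]
  refine div_le_div_of_nonneg_right ?_ (partitionSum_pos J Λ β 0).le
  rw [← sub_nonneg, ← Finset.sum_sub_distrib]
  set θv := volInvol θ Λ hΛ with hθv
  set ua : ↥Λ := ⟨a, ha⟩ with hua
  set ub : ↥Λ := ⟨b, hb⟩ with hub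
  have key : ∀ ω : SpinConfig ↥Λ,
      spinProduct {a, b} (glue Λ ω .free) * pairGibbsWeight J Λ β 0 ω -
        spinProduct {a, θ b} (glue Λ ω .free) * pairGibbsWeight J Λ β 0 ω =
      2 * (sVar θv ua ω * tVar θv ub ω * pairGibbsWeight J Λ β 0 ω) +
        2 * (tVar θv ua ω * tVar θv ub ω * pairGibbsWeight J Λ β 0 ω) := by
    intro ω
    rw [spinProduct, spinProduct, Finset.prod_pair hab, Finset.prod_pair haθb,
      spinAt_glue_of_mem ω _ ha, spinAt_glue_of_mem ω _ hb, spinAt_glue_of_mem ω _ ((hΛ b).1 hb),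
      spinAt_eq_sVar_add_tVar θv ua, spinAt_eq_sVar_add_tVar θv ub,
      show spinAt (⟨θ b, (hΛ b).1 hb⟩ : ↥Λ) ω = spinAt (θv ub) ω from rfl,
      spinAt_apply_eq_sVar_sub_tVar θv ub]
    ring
  simp_rw [key]
  rw [Finset.sum_add_distrib, ← Finset.mul_sum, ← Finset.mul_sum]
  have hW := sum_foldedClass_mul_pairGibbsWeight_nonneg (P := P) hθ hPθ hfix hJ0 hJθ hJP hΛ hβ
  have hPa' : ua ∈ volSide P Λ := (mem_volSide P Λ).2 hPa
  have hPb' : ub ∈ volSide P Λ := (mem_volSide P Λ).2 hPb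
  exact add_nonneg
    (mul_nonneg two_pos.le (hW _ (mul_mem_foldedClass _ _
      (sVar_mem_foldedClass _ _ hPa') (tVar_mem_foldedClass _ _ hPb'))))
    (mul_nonneg two_pos.le (hW _ (mul_mem_foldedClass _ _
      (tVar_mem_foldedClass _ _ hPa') (tVar_mem_foldedClass _ _ hPb'))))

end PairFold

/-! ### The infinite-volume state along symmetrised boxes, and the inequality for the state -/

section StateReflect

variable (J : Site d → Site d → ℝ) (β : ℝ)

/-- **The box state along symmetrised boxes**: for `β ≥ 0`, `J ≥ 0` and `θ` moving boxes by at
most `R`, `⟨σ_A⟩_{Λ_L ∪ θΛ_L,J,0,β} → ⟨σ_A⟩_{J,0,β}`, by the sandwich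
`⟨σ_A⟩_{Λ_L} ≤ ⟨σ_A⟩_{Λ_L ∪ θΛ_L} ≤ ⟨σ_A⟩_{Λ_{L+R}}` (monotonicity of the free correlations in the
volume, Friedli–Velenik 2017, Exercise 3.12). [cite: FriedliVelenik2017, Exercise 3.12, p. 112] -/
theorem tendsto_expectIn_symBox (hβ : 0 ≤ β) (hJ : ∀ x y, 0 ≤ J x y) {θ : Site d ≃ Site d} {R : ℕ}
    (hR : ∀ L, ∀ y ∈ box d L, θ y ∈ box d (L + R)) (A : Finset (Site d)) :
    Tendsto (fun L => expectIn J (symBox θ L) β 0 (spinProduct A)) atTop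
      (𝓝 (state J β 0 (spinProduct A))) := by
  obtain ⟨L₀, hL₀⟩ := exists_forall_subset_box d A
  have hg := tendsto_expectIn_box J β hβ hJ A
  have hf : Tendsto (fun L => expectIn J (box d (L + R)) β 0 (spinProduct A)) atTop
      (𝓝 (state J β 0 (spinProduct A))) :=
    (Filter.tendsto_add_atTop_iff_nat (f := fun L => expectIn J (box d L) β 0 (spinProduct A)) R).2 hg
  refine tendsto_of_tendsto_of_tendsto_of_le_of_le' hg hf ?_ ?_
  · filter_upwards [eventually_ge_atTop L₀] with L hL
    exact expectIn_spinProduct_mono_volume J β hβ hJ (hL₀ L hL) (box_subset_symBox θ L)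
  · filter_upwards [eventually_ge_atTop L₀] with L hL
    exact expectIn_spinProduct_mono_volume J β hβ hJ ((hL₀ L hL).trans (box_subset_symBox θ L))
      (symBox_subset_box hR L)

/-- **The Messager–Miracle-Solé inequality for the infinite-volume state of a ferromagnetic pair
interaction** (pair form): for an involution `θ` of `ℤ^d` moving boxes boundedly, a positive side
`P` with `θ(P) ∩ P = ∅` and all sites off `P ∪ θ(P)` fixed, `β ≥ 0`, and `J ≥ 0` with
`J_{θx,θy} = J_{x,y}` and `J_{x,θy} ≤ J_{x,y}` for distinct `x, y` on the positive side,
`⟨σ_aσ_{θb}⟩_{J,0,β} ≤ ⟨σ_aσ_b⟩_{J,0,β}` for `a ≠ b` on the positive side (Panis 2023, Proposition 3.2: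
"in the infinite volume limit `Λ ↗ ℤ^d` this result can be extended to reflections with respect to
hyperplanes passing through sites or mid-edges; and to … diagonal hyperplanes"; via the
`θ`-symmetric volumes `Λ_L ∪ θΛ_L`). [cite: Panis2023Triviality, Proposition 3.2] -/
theorem state_pair_reflect_le (θ : Site d ≃ Site d) (hθ : Function.Involutive θ)
    (P : Site d → Prop) [DecidablePred P] (hPθ : ∀ x, P x → ¬P (θ x))
    (hfix : ∀ x, ¬P x → ¬P (θ x) → θ x = x)
    (hJ0 : ∀ x y, 0 ≤ J x y) (hJθ : ∀ x y, J (θ x) (θ y) = J x y)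
    (hJP : ∀ x y, P x → P y → x ≠ y → J x (θ y) ≤ J x y)
    {R : ℕ} (hR : ∀ L, ∀ y ∈ box d L, θ y ∈ box d (L + R)) (hβ : 0 ≤ β)
    {a b : Site d} (hPa : P a) (hPb : P b) (hab : a ≠ b) :
    state J β 0 (spinProduct {a, θ b}) ≤ state J β 0 (spinProduct {a, b}) := by
  refine le_of_tendsto_of_tendsto (tendsto_expectIn_symBox J β hβ hJ0 hR {a, θ b})
    (tendsto_expectIn_symBox J β hβ hJ0 hR {a, b}) ?_
  obtain ⟨L₀, hL₀⟩ := exists_forall_subset_box d {a, b}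
  filter_upwards [eventually_ge_atTop L₀] with L hL
  have hsub : ({a, b} : Finset (Site d)) ⊆ symBox θ L := (hL₀ L hL).trans (box_subset_symBox θ L)
  have ha : a ∈ symBox θ L := hsub (Finset.mem_insert_self a {b})
  have hb : b ∈ symBox θ L := hsub (Finset.mem_insert_of_mem (Finset.mem_singleton_self b))
  exact expectIn_pair_reflect_le J θ P (symBox θ L) β hθ hPθ hfix hJ0 hJθ hJP
    (fun x => mem_symBox_iff hθ x) hβ ha hb hPa hPb hab

/-! ### Invariance of the state under signed coordinate permutations preserving `J` -/

/-- Finite-volume correlations along boxes are invariant under a signed coordinate permutation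
`ψ` of `ℤ^d` preserving `J` (`ψ(Λ_L) = Λ_L`; Friedli–Velenik 2017, Exercise 3.14 in finite volume).
[cite: FriedliVelenik2017, Exercise 3.14, p. 115] -/
theorem expectIn_box_spinProduct_map_signedPerm (π : Equiv.Perm (Fin d)) (ε : Fin d → ℤˣ)
    (hJ : ∀ x y, J (Site.signedPerm π ε x) (Site.signedPerm π ε y) = J x y) (h : ℝ) (L : ℕ)
    (A : Finset (Site d)) :
    expectIn J (box d L) β h (spinProduct (A.map (Site.signedPerm π ε).toEmbedding)) =
      expectIn J (box d L) β h (spinProduct A) := by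
  have hbox : (box d L).map (Site.signedPerm π ε).toEmbedding = box d L := by
    ext y
    rw [Finset.mem_map_equiv, Site.signedPerm_symm, signedPerm_mem_box_iff]
  have h1 : spinProduct (A.map (Site.signedPerm π ε).toEmbedding) =
      fun σ : SpinConfig (Site d) => spinProduct A (σ ∘ Site.signedPerm π ε) := by
    funext σ
    rw [spinProduct, spinProduct, Finset.prod_map]
    rfl
  have h2 := expectIn_map_equiv J β h (Site.signedPerm π ε) hJ (box d L) (spinProduct A)
  rw [hbox] at h2
  rw [h1]
  exact h2

/-- **Invariance of the infinite-volume state under the signed coordinate permutations of `ℤ^d`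
preserving `J`**: `⟨σ_{ψ(A)}⟩_{J,h,β} = ⟨σ_A⟩_{J,h,β}` (term by term along the boxes; Friedli–Velenik
2017, Exercise 3.14: the state is "invariant under lattice rotations and reflections").
[cite: FriedliVelenik2017, Exercise 3.14, p. 115] -/
theorem state_spinProduct_map_signedPerm (π : Equiv.Perm (Fin d)) (ε : Fin d → ℤˣ)
    (hJ : ∀ x y, J (Site.signedPerm π ε x) (Site.signedPerm π ε y) = J x y) (h : ℝ)
    (A : Finset (Site d)) :
    state J β h (spinProduct (A.map (Site.signedPerm π ε).toEmbedding)) = state J β h (spinProduct A) := by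
  rw [state, state]
  congr 1
  funext L
  exact expectIn_box_spinProduct_map_signedPerm J β π ε hJ h L A

end StateReflect

end LongRangeIsing

end Literature.Barriers.CriticalPhenomena
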